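import Mathlib
import HarnessLib
import HarnessLib.Audit
import Summits.Langlands.Statement
import Summits.Langlands.Langlands.Theses.OdlyzkoWorldSplit
import Summits.Langlands.Langlands.Theses.HolomorphicLimitSplit
import Summits.Langlands.Langlands.Theorems.LevelOneDyadicRigidity
import Literature.NumberTheory.GaloisRepresentations.CompatibleSystemResidualIrreducibility
import Literature.NumberTheory.GaloisRepresentations.SorensenPatchingHypotheses

/-!
# BrightMateBypass — part 1 (vocabulary, the FAMILY dial with the solvably-reducible CARVE, cells LONE / BRIGHT / AUT↑, lemmas, KERNEL `rno3_iff_lone`)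

Tree twin (STEP T of the lens RUNME) of the decomp-langlands lens-5 g10 node v3 `HOME/nodes/lens-5-g10-BrightMateBypass.lean`
(sha256 259ced12e22b…, 552 lines; v3 = critic rows 153 + 167 fixes F2/F3: dial `SolvablyReducible ρ ∨ SolvablyMated ι ρ`),
on the declared residual RNO₃ = `OdlyzkoWorldSplit.CyclotomicReducibleNonOrdinaryHigherRankLifting` (stmt-Langlands-33910) of route OdlyzkoWorldSplit rev 8.
Lines 1–390 of the node verbatim (§1–§5b); part 2 = `Theorems/BrightMateBypassCert.lean` (§6 `closes`, §7 certificates, §3b one-liners, §8 offer),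
split by census-1 g17 at the 400-line cap. Statements byte-identical to the node; the memo `HOME/nodes/lens-5-g10-BrightMateBypass.md` is the text of record.
Lint normalisation (docstrings only): cite keys `PatrikisSnowdenWiles2018` ↦ `PatrikisSnowdenWiles2016` (IMRN rnw241, same paper) and `BoeckleHui2026` ↦ `BockleHui2025`
(Math. Ann. 393, same paper) so that they resolve in `lean/references.bib`; the AUT↑ docstring names `ArthurClozel1989` in prose (no cite tag — the item is W⁺-conditional, not a Literature fact).
-/

set_option linter.dupNamespace false

namespace Summit.Langlands.Langlands.Theorems.BrightMate

open Filter Polynomial IsDedekindDomain NumberField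
open Literature.NumberTheory.GaloisRepresentations
open Literature.NumberTheory.Automorphic
open Literature.NumberTheory.PAdicHodge
open Literature.NumberTheory.LFunctions
open Summit.Langlands.Langlands.Theses

/-! ## §1 Vocabulary inherited from g9 (`SlopeRankSplit`), verbatim -/

/-- IMAGE DIAL (g8, kept on every cell): «ρ̄|_{Γ_{K(ζ_ℓ)}} is absolutely irreducible» — clause (4) of the tree's `BLGGT2014_thmC_potentialAutomorphy`. -/
def CycIrr {K : Type} [Field K] [NumberField K] {ℓ : ℕ} [Fact ℓ.Prime] {n : ℕ}
    (ρ : FramedGaloisRep K (PadicAlgCl ℓ) n) : Prop :=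
  (ρ.restrictField (CyclotomicField ℓ K)).IsResiduallyAbsIrreducible

/-- SLOPE DIAL «ρ is potentially ordinary with regular labelled weights over some finite solvable Galois L/K» — the inlined IsPotentiallyOrdinary clause of
`ResidualAvatarLadder.CoreReducibleOrdinaryAutomorphy` (stmt-Langlands-31186) VERBATIM (1261 chars). -/
def PotOrd {K : Type} [Field K] [NumberField K] {ℓ : ℕ} [Fact ℓ.Prime] {n : ℕ}
    (ρ : FramedGaloisRep K (PadicAlgCl ℓ) n) : Prop :=
  (∃ (L : Type) (_ : Field L) (_ : NumberField L) (_ : Algebra K L), IsGalois K L ∧ IsSolvable (L ≃ₐ[K] L) ∧ ∀ (w : IsDedekindDomain.HeightOneSpectrum (NumberField.RingOfIntegers L)) (hw : ((ℓ : ℕ) : NumberField.RingOfIntegers L) ∈ w.asIdeal), letI := (Literature.NumberTheory.PAdicHodge.fontainePstAdicCompletion w ℓ hw).algebra; ∃ (g : GL (Fin n) (PadicAlgCl ℓ)) (ψ : Fin n → Literature.NumberTheory.GaloisRepresentations.FramedGaloisRep (w.adicCompletion L) (PadicAlgCl ℓ) 1) (a : Fin n → ((w.adicCompletion L) →ₐ[ℚ_[ℓ]]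 PadicAlgCl ℓ) → ℤ), Literature.NumberTheory.GaloisRepresentations.FramedRep.IsUpperTriangular (((ρ.restrictField L).toLocal w).conj g) ∧ (∀ (σ : Field.absoluteGaloisGroup (w.adicCompletion L)) (i : Fin n), Literature.NumberTheory.GaloisRepresentations.FramedRep.diagEntry (((ρ.restrictField L).toLocal w).conj g) i σ = (ψ i).trace σ) ∧ (∀ i : Fin n, (Literature.NumberTheory.PAdicHodge.fontainePstAdicCompletion w ℓ hw).IsDeRhamFramed (ψ i)) ∧ (∀ (i : Fin n) (τ : (w.adicCompletion L) →ₐ[ℚ_[ℓ]] PadicAlgCl ℓ), (Literature.NumberTheory.PAdicHodge.fontainePstAdicCompletion w ℓ hw).𝔅.labelledHodgeTateWeights (ψ i).toGaloisRep τ.toRingHom = {a i τ}) ∧ (∀ τ : (w.adicCompletion L) →ₐ[ℚ_[ℓ]] PadicAlgCl ℓ, StrictMono (fun i : Fin n => a i τ)))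

/-- The TAIL of Lift_w / R† at one instance: «ρ irreducible → geometric → linked mod 𝔪 to a weakly automorphic irreducible ρ' → ρ weakly automorphic»
(tree text after the binders, verbatim). -/
def LiftTail (K : Type) [Field K] [NumberField K] (n : ℕ) (hcpt : Literature.NumberTheory.Automorphic.isCompact_glFiniteIntegralLevel n K)
    (ℓ : ℕ) [Fact ℓ.Prime] (ι : PadicAlgCl ℓ ≃+* ℂ) (ρ : FramedGaloisRep K (PadicAlgCl ℓ) n) : Prop :=
  ρ.toGaloisRep.IsIrreducible → ((∀ᶠ v : IsDedekindDomain.HeightOneSpectrum (NumberField.RingOfIntegers K) in cofinite, ρ.IsUnramifiedAt v) ∧ ∀ (v : IsDedekindDomain.HeightOneSpectrum (NumberField.RingOfIntegers K)) (hv : ((ℓ : ℕ) : NumberField.RingOfIntegers K) ∈ v.asIdeal), (Literature.NumberTheory.PAdicHodge.fontainePstAdicCompletion v ℓ hv).IsDeRhamFramed (ρ.toLocal v)) → (∃ (π : Literature.NumberTheory.Automorphic.CuspidalAutomorphicRepData n K hcpt) (ρ' : Literature.NumberTheory.GaloisRepresentations.FramedGaloisRep K (PadicAlgCl ℓ) n),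 π.1.IsLAlgebraic ∧ ρ'.toGaloisRep.IsIrreducible ∧ (∀ᶠ v : IsDedekindDomain.HeightOneSpectrum (NumberField.RingOfIntegers K) in cofinite, SatakeFrobCompatibleAt ι π.1 ρ' v) ∧ ∀ᶠ v : IsDedekindDomain.HeightOneSpectrum (NumberField.RingOfIntegers K) in cofinite, ∃ P P' : Polynomial (Valued.v : Valuation (PadicAlgCl ℓ) NNReal).valuationSubring, ρ.HasFrobCharpolyAt v (P.map (Valued.v : Valuation (PadicAlgCl ℓ) NNReal).valuationSubring.subtype) ∧ ρ'.HasFrobCharpolyAt v (P'.map (Valued.v : Valuation (PadicAlgCl ℓ) NNReal).valuationSubring.subtype) ∧ P.map (IsLocalRing.residue (Valued.v : Valuation (PadicAlgCl ℓ) NNReal).valuationSubring) = P'.map (IsLocalRing.residue (Valued.v : Valuation (PadicAlgCl ℓ) NNReal).valuationSubring)) → ∃ π : Literature.NumberTheory.Automorphic.CuspidalAutomorphicRepData n K hcpt, π.1.IsLAlgebraic ∧ ∀ᶠ v : IsDedekindDomain.HeightOneSpectrum (NumberField.RingOfIntegers K) in cofinite, SatakeFrobCompatibleAt ι π.1 ρ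 v

/-- Lift_w AT RANK n. -/
def LiftAt (n : ℕ) : Prop :=
  ∀ (K : Type) [Field K] [NumberField K] (hcpt : Literature.NumberTheory.Automorphic.isCompact_glFiniteIntegralLevel n K), 0 < n →
    ∀ (ℓ : ℕ) [Fact ℓ.Prime] (ι : PadicAlgCl ℓ ≃+* ℂ) (ρ : FramedGaloisRep K (PadicAlgCl ℓ) n), LiftTail K n hcpt ℓ ι ρ

/-- IH(n): Lift_w at every rank m < n (the hypothesis g8 inlined into A†, F†, R†). -/
def LiftBelow (n : ℕ) : Prop :=
  ∀ m : ℕ, m < n → LiftAt m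

/-- RNO₃ structured (g9 `SlopeRankSplit.CyclotomicReducibleNonOrdinaryHigherRankLifting`; definitionally the TREE decl `OdlyzkoWorldSplit.CyclotomicReducibleNonOrdinaryHigherRankLifting`, stmt-Langlands-33910 — see `rno3_tree_iff`). -/
def RNO3 : Prop :=
  ∀ (K : Type) [Field K] [NumberField K] (n : ℕ) (hcpt : Literature.NumberTheory.Automorphic.isCompact_glFiniteIntegralLevel n K), 0 < n → 3 ≤ n →
    LiftBelow n → ∀ (ℓ : ℕ) [Fact ℓ.Prime] (ι : PadicAlgCl ℓ ≃+* ℂ) (ρ : FramedGaloisRep K (PadicAlgCl ℓ) n),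
      ¬ CycIrr ρ → ¬ PotOrd ρ → LiftTail K n hcpt ℓ ι ρ


/-- The TREE decl RNO₃ (stmt-Langlands-33910) IS the structured `RNO3` (definitional). -/
theorem rno3_tree_iff : OdlyzkoWorldSplit.CyclotomicReducibleNonOrdinaryHigherRankLifting ↔ RNO3 := Iff.rfl

/-! ## §2 The FAMILY dial (lens 5: the prime ℓ of the instance is DIALLED AWAY, not attacked)

A **PSW family** of rank `n` over `K` is the tree's rendering (idiom of `IsWeaklyCompatibleSystemRat`,
`CompatibleSystemResidualIrreducibility.lean`, and of `IsWeaklyCompatibleFamily`, `NonSelfDualGL3GL4CompatibleSystems.lean`)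
of an `E`-rational, Hodge–Tate-bounded, crystalline-off-`S` compatible system in the sense of
Patrikis–Snowden–Wiles 2018 §1 / Böckle–Hui 2026 §1 (conditions (E-rational), (HT), (crys)), indexed by the primes of a
set `L` of Dirichlet density one and by the identifications `ι' : ℚ̄_{ℓ'} ≃ ℂ` (the `ι`-dictionary of the module docstring of
`CompatibleSystemResidualIrreducibility.lean`), whose members at the primes of `L` are IRREDUCIBLE.  Members are only
required at a density-one set of primes (Patrikis–Taylor 2015: automorphic systems are irreducible at a density-one set). -/

/-- `IsPSWFamily n S Q I L r`: `r ℓ' ι' : Γ_K → GL_n(ℚ̄_{ℓ'})` (for `ℓ' ∈ L`, any `ι'`) is irreducible, a.e. unramified, unramified with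
Frobenius characteristic polynomial `ι'⁻¹(Q v)` at every `v ∉ S` prime to `ℓ'`, de Rham above `ℓ'`, and crystalline with `τ`-labelled
Hodge–Tate weights in the window `I` at every `v ∣ ℓ'` outside `S`; the `Q v` (`v ∉ S`) have coefficients in one number field `E ⊂ ℂ`;
`L` has Dirichlet density one. [cite: PatrikisSnowdenWiles2016, §1] [cite: BockleHui2025, §1 (E-rational), (HT)] -/
def IsPSWFamily {K : Type} [Field K] [NumberField K] (n : ℕ) (S : Finset (HeightOneSpectrum (𝓞 K)))
    (Q : HeightOneSpectrum (𝓞 K) → Polynomial ℂ) (I : Finset ℤ) (L : Set ℕ)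
    (r : ∀ (ℓ' : ℕ) [Fact ℓ'.Prime], (PadicAlgCl ℓ' ≃+* ℂ) → FramedGaloisRep K (PadicAlgCl ℓ') n) : Prop :=
  (∃ E : Subfield ℂ, FiniteDimensional ℚ E ∧ ∀ v, v ∉ S → ∀ i : ℕ, (Q v).coeff i ∈ E) ∧
  HasDirichletDensity L 1 ∧
  ∀ (ℓ' : ℕ) [Fact ℓ'.Prime], ℓ' ∈ L → ∀ ι' : PadicAlgCl ℓ' ≃+* ℂ,
    (r ℓ' ι').toGaloisRep.IsIrreducible ∧
    (∀ᶠ v : HeightOneSpectrum (𝓞 K) in cofinite, (r ℓ' ι').IsUnramifiedAt v) ∧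
    (∀ v : HeightOneSpectrum (𝓞 K), v ∉ S → ((ℓ' : ℕ) : 𝓞 K) ∉ v.asIdeal →
      (r ℓ' ι').IsUnramifiedAt v ∧ (r ℓ' ι').HasFrobCharpolyAt v ((Q v).map (ι'.symm : ℂ ≃+* PadicAlgCl ℓ').toRingHom)) ∧
    ∀ (v : HeightOneSpectrum (𝓞 K)) (hv : ((ℓ' : ℕ) : 𝓞 K) ∈ v.asIdeal),
      (fontainePstAdicCompletion v ℓ' hv).IsDeRhamFramed ((r ℓ' ι').toLocal v) ∧
      (v ∉ S → (fontainePstAdicCompletion v ℓ' hv).IsCrystallineFramed ((r ℓ' ι').toLocal v) ∧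
        letI := (fontainePstAdicCompletion v ℓ' hv).algebra
        ∀ τ : v.adicCompletion K →ₐ[ℚ_[ℓ']] PadicAlgCl ℓ', ∀ h ∈ (r ℓ' ι').labelledHodgeTateWeightsAt v
          (fontainePstAdicCompletion v ℓ' hv).algebra (fontainePstAdicCompletion v ℓ' hv).𝔅 τ.toRingHom, h ∈ I)

/-- `Through ι ρ S Q`: the instance `(ρ, ι)` itself has Frobenius characteristic polynomials `ι⁻¹(Q v)` at every `v ∉ S` prime to `ℓ`
(so `ρ` is the `(ℓ, ι)`-member of the family «up to semisimplification», stated by characteristic polynomials only). -/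
def Through {K : Type} [Field K] [NumberField K] {ℓ : ℕ} [Fact ℓ.Prime] {n : ℕ} (ι : PadicAlgCl ℓ ≃+* ℂ)
    (ρ : FramedGaloisRep K (PadicAlgCl ℓ) n) (S : Finset (HeightOneSpectrum (𝓞 K))) (Q : HeightOneSpectrum (𝓞 K) → Polynomial ℂ) : Prop :=
  ∀ v : HeightOneSpectrum (𝓞 K), v ∉ S → ((ℓ : ℕ) : 𝓞 K) ∉ v.asIdeal →
    ρ.IsUnramifiedAt v ∧ ρ.HasFrobCharpolyAt v ((Q v).map (ι.symm : ℂ ≃+* PadicAlgCl ℓ).toRingHom)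

/-- `HasFamilyOver ι ρ`: some PSW family over `K` passes through `(ρ, ι)`. -/
def HasFamilyOver {K : Type} [Field K] [NumberField K] {ℓ : ℕ} [Fact ℓ.Prime] {n : ℕ} (ι : PadicAlgCl ℓ ≃+* ℂ)
    (ρ : FramedGaloisRep K (PadicAlgCl ℓ) n) : Prop :=
  ∃ (S : Finset (HeightOneSpectrum (𝓞 K))) (Q : HeightOneSpectrum (𝓞 K) → Polynomial ℂ) (I : Finset ℤ) (L : Set ℕ)
    (r : ∀ (ℓ' : ℕ) [Fact ℓ'.Prime], (PadicAlgCl ℓ' ≃+* ℂ) → FramedGaloisRep K (PadicAlgCl ℓ') n),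
    IsPSWFamily n S Q I L r ∧ Through ι ρ S Q

/-- **THE DIAL** `SolvablyMated ι ρ` (v2 — saturated UPWARD along the print transfer groupoid; critic row 153): a PSW family over `K`
passes through `(ρ, ι)`, OR there are a finite SOLVABLE GALOIS `N/K` and an intermediate layer `K ⊆ M ⊆ N` on which `ρ|_M` is irreducible and
through which a PSW family over `M` passes.  The layer `M` need not be Galois over `K`: typing it inside a solvable hull is what makes the
residual closed under restriction to solvable Galois extensions (memo §4, orbit audit).  Conjecturally (Fontaine–Mazur + Langlands) EVERY
irreducible geometric `ρ` is mated already over `K`; no theorem says so — the complement is the GHOST residual `LoneDarkHigherRankLifting`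
(«absolutely lone»: no solvable layer carries a family through an irreducible restriction of `ρ`). -/
def SolvablyMated {K : Type} [Field K] [NumberField K] {ℓ : ℕ} [Fact ℓ.Prime] {n : ℕ} (ι : PadicAlgCl ℓ ≃+* ℂ)
    (ρ : FramedGaloisRep K (PadicAlgCl ℓ) n) : Prop :=
  HasFamilyOver ι ρ ∨
    ∃ (N : Type) (_ : Field N) (_ : NumberField N) (_ : Algebra K N) (M : Type) (_ : Field M) (_ : NumberField M) (_ : Algebra K M)
      (_ : Algebra M N) (_ : IsScalarTower K M N), IsGalois K N ∧ IsSolvable (N ≃ₐ[K] N) ∧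
      (ρ.restrictField M).toGaloisRep.IsIrreducible ∧ HasFamilyOver ι (ρ.restrictField M)

/-- **THE CARVE (v3, critic row 167 F3).** `ρ` is SOLVABLY REDUCIBLE: over some finite solvable Galois `E/K` (`E = K` allowed) the
restriction `ρ|_E` has a proper irreducible GEOMETRIC trace-constituent `ϑ` of rank `0 < m < n` (Clifford: solvably induced or solvably
isotypic `ρ`).  These instances are closed WITHOUT any family by binders the kit already has — IH(m) at `(E, ϑ)` (link fed by Serre_w + W⁺)
and CSD down `E → K` (`weakAut_of_solvablyReducible`) — so they must not be booked in the residual.  Geometricity of `ϑ` sits INSIDE the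
existential (a summand of a geometric representation is geometric on paper; the tree has no such lemma), the constituent clause is CSD's own. -/
def SolvablyReducible {K : Type} [Field K] [NumberField K] {ℓ : ℕ} [Fact ℓ.Prime] {n : ℕ}
    (ρ : FramedGaloisRep K (PadicAlgCl ℓ) n) : Prop :=
  ∃ (E : Type) (_ : Field E) (_ : NumberField E) (_ : Algebra K E), IsGalois K E ∧ IsSolvable (E ≃ₐ[K] E) ∧
    ∃ (m : ℕ) (ϑ : FramedGaloisRep E (PadicAlgCl ℓ) m), m < n ∧ 0 < m ∧ ϑ.toGaloisRep.IsIrreducible ∧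
      ((∀ᶠ v : HeightOneSpectrum (𝓞 E) in cofinite, ϑ.IsUnramifiedAt v) ∧
        ∀ (v : HeightOneSpectrum (𝓞 E)) (hv : ((ℓ : ℕ) : 𝓞 E) ∈ v.asIdeal), (fontainePstAdicCompletion v ℓ hv).IsDeRhamFramed (ϑ.toLocal v)) ∧
      (∃ (mc : ℕ) (θc : FramedGaloisRep E (PadicAlgCl ℓ) mc), ∀ g : Field.absoluteGaloisGroup E,
        FramedRep.trace (ρ.restrictField E) g = FramedRep.trace ϑ g + FramedRep.trace θc g)

/-! ## §3 The cells

* `LoneDarkHigherRankLifting` (LONE, crux, DECLARED RESIDUAL, ghost): RNO₃ on the instances with `¬ SolvablyReducible ρ` and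
  `¬ SolvablyMated ι ρ` («solvably irreducible and absolutely lone»; v3 = v2 + the row-167 carve).
* `DensityOneCyclotomicBrightness` (BRIGHT, support, PRINT): in a PSW family the members `r ℓ' ι'` have `r̄|_{K(ζ_{ℓ'})}` absolutely
  irreducible for all `ℓ'` in a density-one subset — Patrikis–Snowden–Wiles 2018 Cor. 18 with Böckle–Hui 2026 Thm 1.3(i)/1.4 supplying
  strong `E'`-rationality for `ℚ̄`-coefficients. [cite: PatrikisSnowdenWiles2016, Thm 2, Cor 18] [cite: BockleHui2025, Thm 1.3, Thm 1.4, §7]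
* `SolvableAscentConstituent` (AUT↑, support, PRINT given W⁺): solvable Galois ascent of weak automorphy to SOME Clifford constituent
  (Arthur–Clozel base change + Clifford), in the trace-constituent currency of the tree items `HolomorphicLimitSplit.SolvableGaloisAscent` /
  `CliffordSolvableDescent` (CSD, used BY NAME: solvable Galois descent of weak automorphy from one constituent, PRINT given W⁺).
* FRAME `HigherRankDarkLiftingFrame` (support): the host complement `RNO₃ → Langlands`, certified from the host's other items (`frame_of_host`). -/

/-- LONE — RNO₃ on the SOLVABLY IRREDUCIBLE, ABSOLUTELY LONE instances (`¬ SolvablyReducible ρ`, `¬ SolvablyMated ι ρ`): the declared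
residual of this node (ghost: conjecturally vacuous, emptiness not in print).  Caveat of record (critic rows 153/167): the MATED side is closed
under restriction to solvable layers only modulo density-one member irreducibility of restricted families (Larsen–Pink type, not in the tree);
on the solvably-irreducible box the hull dial is otherwise exact under ⊗χ / restriction / descent. -/
def LoneDarkHigherRankLifting : Prop :=
  ∀ (K : Type) [Field K] [NumberField K] (n : ℕ) (hcpt : Literature.NumberTheory.Automorphic.isCompact_glFiniteIntegralLevel n K), 0 < n → 3 ≤ n →
    LiftBelow n → ∀ (ℓ : ℕ) [Fact ℓ.Prime] (ι : PadicAlgCl ℓ ≃+* ℂ) (ρ : FramedGaloisRep K (PadicAlgCl ℓ) n),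
      ¬ CycIrr ρ → ¬ PotOrd ρ → ¬ SolvablyReducible ρ → ¬ SolvablyMated ι ρ → LiftTail K n hcpt ℓ ι ρ

/-- BRIGHT — density-one cyclotomic residual irreducibility in a PSW family (PRINT: PSW 2018 Cor. 18 ⊕ Böckle–Hui 2026 Thm 1.3(i)). -/
def DensityOneCyclotomicBrightness : Prop :=
  ∀ (K : Type) [Field K] [NumberField K] (n : ℕ) (S : Finset (HeightOneSpectrum (𝓞 K))) (Q : HeightOneSpectrum (𝓞 K) → Polynomial ℂ)
    (I : Finset ℤ) (L : Set ℕ) (r : ∀ (ℓ' : ℕ) [Fact ℓ'.Prime], (PadicAlgCl ℓ' ≃+* ℂ) → FramedGaloisRep K (PadicAlgCl ℓ') n),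
    IsPSWFamily n S Q I L r → ∃ L' : Set ℕ, L' ⊆ L ∧ HasDirichletDensity L' 1 ∧
      ∀ (ℓ' : ℕ) [Fact ℓ'.Prime], ℓ' ∈ L' → ∀ ι' : PadicAlgCl ℓ' ≃+* ℂ, CycIrr (r ℓ' ι')

/-- AUT↑ — SOLVABLE GALOIS ASCENT OF WEAK AUTOMORPHY TO A CONSTITUENT (support, PRINT given W⁺ — the antecedent is the host item W⁺ by name; stated in
the trace-constituent currency of the tree items `HolomorphicLimitSplit.SolvableGaloisAscent` / `CliffordSolvableDescent`): `ρ : Γ_M → GL_n(ℚ̄_ℓ)`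
irreducible and weakly automorphic over `M` (for every level structure a cuspidal L-algebraic `π`, Satake–Frobenius compatible a.e.), `N/M` finite
solvable Galois ⇒ SOME irreducible constituent `ϑ` of `ρ|_N` (`tr ρ|_N = tr ϑ + tr ϑᶜ`) of rank `m ≥ 1` is weakly automorphic over `N`.  Print:
base change of `π` along the cyclic prime layers of `N/M` (Arthur–Clozel III.4.2, III.5.1: at each layer cuspidal or an isobaric orbit sum, III.6.2),
Clifford (`ρ|_N` is semisimple with `Gal(N/M)`-conjugate constituents), and identification of one cuspidal constituent of `BC_{N/M}(π)` with one
Clifford constituent through the W⁺ avatars, Chebotarev and Brauer–Nesbitt; L-algebraicity is preserved. (Print refs: `ArthurClozel1989` III.4.2, III.5.1, III.6.2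
— written without a cite tag on purpose: this is a cell SUPPORT ITEM conditional on the host item W⁺, not a Literature fact, and must not be relocated.) -/
def SolvableAscentConstituent : Prop :=
  OdlyzkoWorldSplit.SatakeAvatarExistence →
    ∀ (M : Type) [Field M] [NumberField M] (n : ℕ) (ℓ : ℕ) [Fact ℓ.Prime] (ι : PadicAlgCl ℓ ≃+* ℂ) (ρ : FramedGaloisRep M (PadicAlgCl ℓ) n),
      ρ.toGaloisRep.IsIrreducible → 0 < n →
      (∀ hcpt : Literature.NumberTheory.Automorphic.isCompact_glFiniteIntegralLevel n M,
        ∃ π : CuspidalAutomorphicRepData n M hcpt, π.1.IsLAlgebraic ∧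
          ∀ᶠ v : HeightOneSpectrum (𝓞 M) in cofinite, SatakeFrobCompatibleAt ι π.1 ρ v) →
      ∀ (N : Type) [Field N] [NumberField N] [Algebra M N], IsGalois M N → IsSolvable (N ≃ₐ[M] N) →
        ∃ (m : ℕ) (ϑ : FramedGaloisRep N (PadicAlgCl ℓ) m), ϑ.toGaloisRep.IsIrreducible ∧
          (∃ (mc : ℕ) (θc : FramedGaloisRep N (PadicAlgCl ℓ) mc), ∀ g : Field.absoluteGaloisGroup N,
            FramedRep.trace (ρ.restrictField N) g = FramedRep.trace ϑ g + FramedRep.trace θc g) ∧ 0 < m ∧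
          ∀ hcptN : Literature.NumberTheory.Automorphic.isCompact_glFiniteIntegralLevel m N,
            ∃ π : CuspidalAutomorphicRepData m N hcptN, π.1.IsLAlgebraic ∧
              ∀ᶠ v : HeightOneSpectrum (𝓞 N) in cofinite, SatakeFrobCompatibleAt ι π.1 ϑ v

/-- FRAME — the host complement of RNO₃ in `OdlyzkoWorldSplit.closes` (alias; certified from the host's other items in `frame_of_host`; never staffed). -/
def HigherRankDarkLiftingFrame : Prop :=
  OdlyzkoWorldSplit.CyclotomicReducibleNonOrdinaryHigherRankLifting → _root_.Langlands

/-! ## §4 Lemmas: places away from a rational prime; transport of Satake compatibility along the family -/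

-- (v2: «only finitely many places divide a nonzero natural number» is CITED from the tree —
-- `LevelOneDyadic.eventually_natCast_notMem` [Theorems/LevelOneDyadicRigidity.lean] — census L776 dedup.landed fix.)

/-- The complex «Satake polynomial» `∏ (X - a⁻¹)` of a multiset of Satake parameters. -/
noncomputable def satakePolyC (α : Multiset ℂ) : Polynomial ℂ :=
  (α.map fun a => X - C a⁻¹).prod

/-- At motivic weight parameter `m = 1` the tree's `arithFrobPolyOfSatake ι q 1 α` is the `ι⁻¹`-image of `satakePolyC α`. -/
theorem arithFrobPolyOfSatake_one_eq_map {ℓ : ℕ} [Fact ℓ.Prime] (ι : PadicAlgCl ℓ ≃+* ℂ) (q : ℕ) (α : Multiset ℂ) :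
    arithFrobPolyOfSatake ι q 1 α = (satakePolyC α).map (ι.symm : ℂ ≃+* PadicAlgCl ℓ).toRingHom := by
  rw [arithFrobPolyOfSatake_one, satakePolyC, Polynomial.map_multiset_prod, Multiset.map_map]
  congr 1
  refine Multiset.map_congr rfl fun a _ => ?_
  simp [Polynomial.map_sub, Polynomial.map_X, Polynomial.map_C]

/-- PRIME SWITCH for Satake polynomials: if `ι'⁻¹`-Satake polynomial of `α` is `ι'⁻¹(Q)` then the `ι⁻¹`-Satake polynomial of `α` is `ι⁻¹(Q)`. -/
theorem arithFrobPolyOfSatake_switch {ℓ ℓ' : ℕ} [Fact ℓ.Prime] [Fact ℓ'.Prime] (ι : PadicAlgCl ℓ ≃+* ℂ) (ι' : PadicAlgCl ℓ' ≃+* ℂ)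
    (q : ℕ) (α : Multiset ℂ) (Q : Polynomial ℂ)
    (h : arithFrobPolyOfSatake ι' q 1 α = Q.map (ι'.symm : ℂ ≃+* PadicAlgCl ℓ').toRingHom) :
    arithFrobPolyOfSatake ι q 1 α = Q.map (ι.symm : ℂ ≃+* PadicAlgCl ℓ).toRingHom := by
  rw [arithFrobPolyOfSatake_one_eq_map] at h ⊢
  have hinj : Function.Injective (ι'.symm : ℂ ≃+* PadicAlgCl ℓ').toRingHom := (ι'.symm : ℂ ≃+* PadicAlgCl ℓ').injective
  rw [Polynomial.map_injective _ hinj h]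

/-- TRANSPORT of Satake–Frobenius compatibility from a family mate `r` (at `ℓ', ι'`) to `ρ` (at `ℓ, ι`) at a place where both have
Frobenius characteristic polynomial `Q` (read through `ι'`, `ι` respectively). -/
theorem satakeFrobCompatibleAt_switch {K : Type} [Field K] [NumberField K] {n : ℕ}
    {hcpt : Literature.NumberTheory.Automorphic.isCompact_glFiniteIntegralLevel n K}
    {ℓ ℓ' : ℕ} [Fact ℓ.Prime] [Fact ℓ'.Prime] (ι : PadicAlgCl ℓ ≃+* ℂ) (ι' : PadicAlgCl ℓ' ≃+* ℂ)
    (π : CuspidalAutomorphicRepData n K hcpt) (ρ : FramedGaloisRep K (PadicAlgCl ℓ) n) (r : FramedGaloisRep K (PadicAlgCl ℓ') n)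
    (v : HeightOneSpectrum (𝓞 K)) (Q : Polynomial ℂ)
    (hρu : ρ.IsUnramifiedAt v) (hρQ : ρ.HasFrobCharpolyAt v (Q.map (ι.symm : ℂ ≃+* PadicAlgCl ℓ).toRingHom))
    (hrQ : r.HasFrobCharpolyAt v (Q.map (ι'.symm : ℂ ≃+* PadicAlgCl ℓ').toRingHom))
    (h : SatakeFrobCompatibleAt ι' π.1 r v) : SatakeFrobCompatibleAt ι π.1 ρ v := by
  obtain ⟨α, hα, _, hfrob⟩ := h
  refine ⟨α, hα, hρu, ?_⟩
  rw [arithFrobPolyOfSatake_switch ι ι' v.residueCard α Q (hfrob.unique hrQ)]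
  exact hρQ

/-! ## §5 KERNEL — the bright-mate bypass -/

/-- Serre_w from the host's two world items (the host's own seam, `OdlyzkoWorldSplit.closes`, verbatim). -/
theorem serre_of_worlds (hOW : OdlyzkoWorldSplit.OdlyzkoWorldAutomorphy) (hRES : OdlyzkoWorldSplit.TransOdlyzkoAutomorphy) :
    ResidualSplit.ResidualAutomorphy := by
  intro K _ _ n hcpt hn ℓ _ ι ρ hirr hgeo
  exact (Classical.em _).elim (hOW K n hcpt hn ℓ ι ρ hirr hgeo) (hRES hOW K n hcpt hn ℓ ι ρ hirr hgeo)

/-- **BYPASS AT ONE INSTANCE.** If `(ρ, ι)` has a PSW family over `K`, then — modulo BRIGHT (print), Serre_w, W⁺ and A† at rank `n` with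
its inductive hypothesis — `ρ` is weakly automorphic: pick a BRIGHT mate `r ℓ' ι'` at a prime `ℓ' ≥ 2(n+1)` of the density-one bright set
(such primes exist: a density-one set of primes is unbounded), make it residually automorphic (Serre_w) with an irreducible weakly compatible
avatar (W⁺), lift it (A†: its box is exactly «`ℓ' ≥ 2(n+1)` ∧ `r̄|_{K(ζ_{ℓ'})}` abs. irreducible»), and carry the cuspidal `π` back to `(ρ, ι)`
through the common complex Frobenius polynomials `Q v` (`satakeFrobCompatibleAt_switch`).  The dark prime `ℓ` is never touched. -/
theorem weakAut_of_hasFamilyOver (hB : DensityOneCyclotomicBrightness) (hS : ResidualSplit.ResidualAutomorphy)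
    (hW : OdlyzkoWorldSplit.SatakeAvatarExistence) (hA : OdlyzkoWorldSplit.IrreducibleLargePrimeLifting)
    (K : Type) [Field K] [NumberField K] (n : ℕ) (hcpt : Literature.NumberTheory.Automorphic.isCompact_glFiniteIntegralLevel n K)
    (hn : 0 < n) (ih : LiftBelow n) (ℓ : ℕ) [Fact ℓ.Prime] (ι : PadicAlgCl ℓ ≃+* ℂ) (ρ : FramedGaloisRep K (PadicAlgCl ℓ) n)
    (hfam : HasFamilyOver ι ρ) :
    ∃ π : CuspidalAutomorphicRepData n K hcpt, π.1.IsLAlgebraic ∧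
      ∀ᶠ v : HeightOneSpectrum (𝓞 K) in cofinite, SatakeFrobCompatibleAt ι π.1 ρ v := by
  classical
  obtain ⟨S, Q, I, L, r, hF, hρ⟩ := hfam
  -- BRIGHT: a density-one set L' ⊆ L of cyclotomically bright members
  obtain ⟨L', hL'L, hdens, hbright⟩ := hB K n S Q I L r hF
  -- a bright prime ℓ' > 2(n+1) (density one ⇒ unbounded; the tree's `PrimeSum.exists_gt_of_tendsto_pos`)
  obtain ⟨ℓ', hℓ'p, hℓ'L', hbig⟩ :=
    PrimeSum.exists_gt_of_tendsto_pos (X := L') one_pos (by convert hasDirichletDensity_iff.mp hdens using 3) (2 * (n + 1))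
  haveI : Fact ℓ'.Prime := ⟨hℓ'p⟩
  obtain ⟨ι'⟩ := PadicAlgCl.nonempty_ringEquiv_complex ℓ'
  obtain ⟨hirr', hunr', hfrob', hpadic'⟩ := hF.2.2 ℓ' (hL'L hℓ'L') ι'
  have hgeo' : (∀ᶠ v : HeightOneSpectrum (𝓞 K) in cofinite, (r ℓ' ι').IsUnramifiedAt v) ∧
      ∀ (v : HeightOneSpectrum (𝓞 K)) (hv : ((ℓ' : ℕ) : 𝓞 K) ∈ v.asIdeal),
        (fontainePstAdicCompletion v ℓ' hv).IsDeRhamFramed ((r ℓ' ι').toLocal v) :=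
    ⟨hunr', fun v hv => (hpadic' v hv).1⟩
  -- Serre_w at the bright prime, then W⁺: the congruent weakly automorphic irreducible avatar (seam of `ResidualSplit.closes`, verbatim)
  obtain ⟨π₀, hLπ₀, hcong⟩ := hS K n hcpt hn ℓ' ι' (r ℓ' ι') hirr' hgeo'
  obtain ⟨ρ', hirrρ', hρ'⟩ := hW K n hcpt hn π₀ hLπ₀ ℓ' ι'
  -- A† at the bright prime (box: 2(n+1) ≤ ℓ' and r̄|K(ζ_ℓ') abs. irreducible; IH(n) is RNO₃'s own)
  obtain ⟨π, hLπ, hsat⟩ := hA K n hcpt hn ih ℓ' ι' (r ℓ' ι') hbig.le (hbright ℓ' hℓ'L' ι') hirr' hgeo'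
    ⟨π₀, ρ', hLπ₀, hirrρ', hρ', by
      filter_upwards [hcong, hρ'] with v ⟨_, _, hall⟩ ⟨α, hα, _, hfrobα⟩
      obtain ⟨P, Q', hP, hQ', hPQ'⟩ := hall α hα
      exact ⟨P, Q', hP, hQ' ▸ hfrobα, hPQ'⟩⟩
  -- transport π back to (ρ, ι) along the common Frobenius polynomials Q v, at the cofinitely many v ∉ S prime to ℓ ℓ'
  refine ⟨π, hLπ, ?_⟩
  filter_upwards [hsat, LevelOneDyadic.eventually_natCast_notMem K ℓ (Fact.out : ℓ.Prime).ne_zero,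
    LevelOneDyadic.eventually_natCast_notMem K ℓ' hℓ'p.ne_zero, S.eventually_cofinite_notMem] with v hv hvℓ hvℓ' hvS
  obtain ⟨hρu, hρQ⟩ := hρ v hvS hvℓ
  exact satakeFrobCompatibleAt_switch ι ι' π ρ (r ℓ' ι') v (Q v) hρu hρQ (hfrob' v hvS hvℓ').2 hv

/-- The bypass in `LiftTail` form (the three antecedents of the tail are not needed for a mated instance). -/
theorem liftTail_of_hasFamilyOver (hB : DensityOneCyclotomicBrightness) (hS : ResidualSplit.ResidualAutomorphy)
    (hW : OdlyzkoWorldSplit.SatakeAvatarExistence) (hA : OdlyzkoWorldSplit.IrreducibleLargePrimeLifting)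
    (K : Type) [Field K] [NumberField K] (n : ℕ) (hcpt : Literature.NumberTheory.Automorphic.isCompact_glFiniteIntegralLevel n K)
    (hn : 0 < n) (ih : LiftBelow n) (ℓ : ℕ) [Fact ℓ.Prime] (ι : PadicAlgCl ℓ ≃+* ℂ) (ρ : FramedGaloisRep K (PadicAlgCl ℓ) n)
    (hfam : HasFamilyOver ι ρ) : LiftTail K n hcpt ℓ ι ρ := by
  intro _ _ _
  exact weakAut_of_hasFamilyOver hB hS hW hA K n hcpt hn ih ℓ ι ρ hfam

/-! ### §5b The solvable layer: Galois/solvable at the top of a tower, traces under tower conjugacy, and the SATURATED bypass -/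

/-- Solvability passes to the top of a tower `K ⊆ M ⊆ N` (restriction of scalars embeds `Aut(N/M)` into `Aut(N/K)`). -/
theorem isSolvable_algEquiv_top (K M N : Type) [Field K] [Field M] [Field N] [Algebra K N] [Algebra K M] [Algebra M N]
    [IsScalarTower K M N] (h : IsSolvable (N ≃ₐ[K] N)) : IsSolvable (N ≃ₐ[M] N) := by
  let f : (N ≃ₐ[M] N) →* (N ≃ₐ[K] N) :=
    { toFun := fun σ => σ.restrictScalars K
      map_one' := AlgEquiv.ext fun _ => rfl
      map_mul' := fun _ _ => AlgEquiv.ext fun _ => rfl }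
  exact solvable_of_solvable_injective (f := f) (AlgEquiv.restrictScalars_injective K)

/-- Traces do not see the tower conjugacy `(ρ|_M)|_N ∼ ρ|_N` (tree: `SorensenPatching.exists_absGaloisRestrict_absGaloisRestrict_eq_conj`). -/
theorem trace_restrictField_restrictField (K M N : Type) [Field K] [Field M] [Field N] [Algebra K N] [Algebra K M] [Algebra M N]
    [IsScalarTower K M N] {ℓ : ℕ} [Fact ℓ.Prime] {n : ℕ} (ρ : FramedGaloisRep K (PadicAlgCl ℓ) n) (g : Field.absoluteGaloisGroup N) :
    FramedRep.trace ((ρ.restrictField M).restrictField N) g = FramedRep.trace (ρ.restrictField N) g := by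
  obtain ⟨τ, hτ⟩ := SorensenPatching.exists_absGaloisRestrict_absGaloisRestrict_eq_conj K M N
  simp only [FramedRep.trace, FramedGaloisRep.restrictField_apply, hτ, map_mul, map_inv, Units.val_mul]
  rw [Matrix.trace_mul_cycle, ← Units.val_mul, inv_mul_cancel, Units.val_one, one_mul]

/-- **THE CARVED BOX IS KIT-CLOSED (v3, F3b).** A solvably reducible irreducible geometric `ρ` is weakly automorphic modulo Serre_w, W⁺,
CSD and RNO₃'s own inductive hypothesis — NO family: IH(m) at the constituent `ϑ` over `E` (rank `m < n`; the link antecedent of `LiftTail`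
fed by Serre_w + W⁺ exactly as for a bright mate), then CSD down `E → K`. -/
theorem weakAut_of_solvablyReducible (hS : ResidualSplit.ResidualAutomorphy) (hW : OdlyzkoWorldSplit.SatakeAvatarExistence)
    (hCSD : HolomorphicLimitSplit.CliffordSolvableDescent)
    (K : Type) [Field K] [NumberField K] (n : ℕ) (hcpt : Literature.NumberTheory.Automorphic.isCompact_glFiniteIntegralLevel n K)
    (hn : 0 < n) (ih : LiftBelow n) (ℓ : ℕ) [Fact ℓ.Prime] (ι : PadicAlgCl ℓ ≃+* ℂ) (ρ : FramedGaloisRep K (PadicAlgCl ℓ) n)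
    (hirr : ρ.toGaloisRep.IsIrreducible)
    (hgeo : (∀ᶠ v : HeightOneSpectrum (𝓞 K) in cofinite, ρ.IsUnramifiedAt v) ∧
      ∀ (v : HeightOneSpectrum (𝓞 K)) (hv : ((ℓ : ℕ) : 𝓞 K) ∈ v.asIdeal), (fontainePstAdicCompletion v ℓ hv).IsDeRhamFramed (ρ.toLocal v))
    (hsr : SolvablyReducible ρ) :
    ∃ π : CuspidalAutomorphicRepData n K hcpt, π.1.IsLAlgebraic ∧
      ∀ᶠ v : HeightOneSpectrum (𝓞 K) in cofinite, SatakeFrobCompatibleAt ι π.1 ρ v := by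
  obtain ⟨E, _, _, _, hGal, hSolv, m, ϑ, hmn, hm, hϑirr, hϑgeo, hθ⟩ := hsr
  refine hCSD hW K n ℓ ι ρ hirr hgeo hn E hGal hSolv m ϑ hϑirr hθ hm (fun hcptE => ?_) hcpt
  -- IH(m) at (E, ϑ): the link antecedent from Serre_w + W⁺
  obtain ⟨π₀, hLπ₀, hcong⟩ := hS E m hcptE hm ℓ ι ϑ hϑirr hϑgeo
  obtain ⟨ρ', hirrρ', hρ'⟩ := hW E m hcptE hm π₀ hLπ₀ ℓ ι
  refine ih m hmn E hcptE hm ℓ ι ϑ hϑirr hϑgeo ⟨π₀, ρ', hLπ₀, hirrρ', hρ', ?_⟩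
  filter_upwards [hcong, hρ'] with v ⟨_, _, hall⟩ ⟨α, hα, _, hfrobα⟩
  obtain ⟨P, Q', hP, hQ', hPQ'⟩ := hall α hα
  exact ⟨P, Q', hP, hQ' ▸ hfrobα, hPQ'⟩

/-- **SATURATED BYPASS.** A solvably mated irreducible geometric `ρ` is weakly automorphic, modulo BRIGHT, Serre_w, W⁺, A† (with the inductive
hypothesis) and the two solvable-layer supports AUT↑ / CSD: run the bypass over the layer `M` at every level structure, ascend `M → N` to a
weakly automorphic Clifford constituent `ϑ` of `ρ|_N` (AUT↑; `N/M` is solvable Galois as the top of the tower), and descend `N → K` (CSD). -/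
theorem weakAut_of_solvablyMated (hB : DensityOneCyclotomicBrightness) (hS : ResidualSplit.ResidualAutomorphy)
    (hW : OdlyzkoWorldSplit.SatakeAvatarExistence) (hA : OdlyzkoWorldSplit.IrreducibleLargePrimeLifting)
    (hUp : SolvableAscentConstituent) (hCSD : HolomorphicLimitSplit.CliffordSolvableDescent)
    (K : Type) [Field K] [NumberField K] (n : ℕ) (hcpt : Literature.NumberTheory.Automorphic.isCompact_glFiniteIntegralLevel n K)
    (hn : 0 < n) (ih : LiftBelow n) (ℓ : ℕ) [Fact ℓ.Prime] (ι : PadicAlgCl ℓ ≃+* ℂ) (ρ : FramedGaloisRep K (PadicAlgCl ℓ) n)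
    (hirr : ρ.toGaloisRep.IsIrreducible)
    (hgeo : (∀ᶠ v : HeightOneSpectrum (𝓞 K) in cofinite, ρ.IsUnramifiedAt v) ∧
      ∀ (v : HeightOneSpectrum (𝓞 K)) (hv : ((ℓ : ℕ) : 𝓞 K) ∈ v.asIdeal), (fontainePstAdicCompletion v ℓ hv).IsDeRhamFramed (ρ.toLocal v))
    (hsm : SolvablyMated ι ρ) :
    ∃ π : CuspidalAutomorphicRepData n K hcpt, π.1.IsLAlgebraic ∧
      ∀ᶠ v : HeightOneSpectrum (𝓞 K) in cofinite, SatakeFrobCompatibleAt ι π.1 ρ v := by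
  rcases hsm with hfam | ⟨N, _, _, _, M, _, _, _, _, _, hGal, hSolv, hirrM, hfamM⟩
  · exact weakAut_of_hasFamilyOver hB hS hW hA K n hcpt hn ih ℓ ι ρ hfam
  · -- the bypass over the layer M, at every level structure
    have hautM : ∀ hcptM : Literature.NumberTheory.Automorphic.isCompact_glFiniteIntegralLevel n M,
        ∃ π : CuspidalAutomorphicRepData n M hcptM, π.1.IsLAlgebraic ∧
          ∀ᶠ v : HeightOneSpectrum (𝓞 M) in cofinite, SatakeFrobCompatibleAt ι π.1 (ρ.restrictField M) v :=
      fun hcptM => weakAut_of_hasFamilyOver hB hS hW hA M n hcptM hn ih ℓ ι (ρ.restrictField M) hfamM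
    -- ascent M → N (AUT↑): N/M is solvable Galois as the top of the tower K ⊆ M ⊆ N
    haveI : IsGalois M N := IsGalois.tower_top_of_isGalois K M N
    obtain ⟨m, ϑ, hϑirr, ⟨mc, θc, htr⟩, hm, hϑaut⟩ :=
      hUp hW M n ℓ ι (ρ.restrictField M) hirrM hn hautM N inferInstance (isSolvable_algEquiv_top K M N hSolv)
    -- descent N → K (CSD): ϑ is a constituent of ρ|_N too, traces being blind to the tower conjugacy
    exact hCSD hW K n ℓ ι ρ hirr hgeo hn N hGal hSolv m ϑ hϑirr
      ⟨mc, θc, fun g => (trace_restrictField_restrictField K M N ρ g).symm.trans (htr g)⟩ hm hϑaut hcpt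

/-- **THE NODE KERNEL: LONE ∧ BRIGHT ∧ AUT↑ ⟹ RNO₃ modulo {OW, RES, W⁺, A†, CSD} (tree items, by name).** Two excluded middles:
the carve `SolvablyReducible ρ` (closed family-free), then the dial `SolvablyMated ι ρ` (closed by the saturated bypass). -/
theorem rno3_of_lone (hL : LoneDarkHigherRankLifting) (hB : DensityOneCyclotomicBrightness)
    (hOW : OdlyzkoWorldSplit.OdlyzkoWorldAutomorphy) (hRES : OdlyzkoWorldSplit.TransOdlyzkoAutomorphy)
    (hW : OdlyzkoWorldSplit.SatakeAvatarExistence) (hA : OdlyzkoWorldSplit.IrreducibleLargePrimeLifting)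
    (hUp : SolvableAscentConstituent) (hCSD : HolomorphicLimitSplit.CliffordSolvableDescent) :
    OdlyzkoWorldSplit.CyclotomicReducibleNonOrdinaryHigherRankLifting := by
  intro K _ _ n hcpt hn h3 ih ℓ _ ι ρ hc hnpo
  by_cases hsr : SolvablyReducible ρ
  · intro hirr hgeo _
    exact weakAut_of_solvablyReducible (serre_of_worlds hOW hRES) hW hCSD K n hcpt hn ih ℓ ι ρ hirr hgeo hsr
  by_cases hsm : SolvablyMated ι ρ
  · intro hirr hgeo _
    exact weakAut_of_solvablyMated hB (serre_of_worlds hOW hRES) hW hA hUp hCSD K n hcpt hn ih ℓ ι ρ hirr hgeo hsm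
  · exact hL K n hcpt hn h3 ih ℓ ι ρ hc hnpo hsr hsm

/-- RNO₃ ⟹ LONE (LONE is RNO₃ on a sub-box: exactness / necessity). -/
theorem lone_of_rno3 (h : OdlyzkoWorldSplit.CyclotomicReducibleNonOrdinaryHigherRankLifting) : LoneDarkHigherRankLifting :=
  fun K _ _ n hcpt hn h3 ih ℓ _ ι ρ hc hnpo _ _ => h K n hcpt hn h3 ih ℓ ι ρ hc hnpo

/-- **RNO₃ ⟺ LONE modulo {BRIGHT, AUT↑ (print), CSD (print mod W⁺, tree item), OW, RES, W⁺, A† (open host items)}.** -/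
theorem rno3_iff_lone (hB : DensityOneCyclotomicBrightness)
    (hOW : OdlyzkoWorldSplit.OdlyzkoWorldAutomorphy) (hRES : OdlyzkoWorldSplit.TransOdlyzkoAutomorphy)
    (hW : OdlyzkoWorldSplit.SatakeAvatarExistence) (hA : OdlyzkoWorldSplit.IrreducibleLargePrimeLifting)
    (hUp : SolvableAscentConstituent) (hCSD : HolomorphicLimitSplit.CliffordSolvableDescent) :
    OdlyzkoWorldSplit.CyclotomicReducibleNonOrdinaryHigherRankLifting ↔ LoneDarkHigherRankLifting :=
  ⟨lone_of_rno3, fun hL => rno3_of_lone hL hB hOW hRES hW hA hUp hCSD⟩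

end Summit.Langlands.Langlands.Theorems.BrightMate
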